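import Literature.NumberTheory.Rogawski1990.CMLocalAPacketMembers        -- ★ `Rogawski1990.qsForm` (`Φ₃ = antidiag(1,1,1)`)
import Literature.NumberTheory.Automorphic.UnitaryGroupFormTransport     -- ★ `formCongr σ B M = σ(B)ᵀ M B`
import Literature.AlgebraicGeometry.ShimuraVarieties.UnitaryBallQuotientDatum  -- ★ `hermForm σ H u v = (σ ∘ u) ⬝ᵥ (H *ᵥ v)`
import Literature.NumberTheory.Automorphic.AdelicUnitaryGroup            -- ★ `cmConjRingHom`
import HarnessLib

/-!
# R90-TF · S9 «InnerForm-13.3.6 (c)» — ★ fragment for the §14.6 organ (B4): an ANISOTROPIC hermitian `H ∈ M₃(L)` is NOT similar to `a · Φ₃`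
# («`G′ = U(H)` is not isomorphic to `G = U(Φ₃)` over `F = L⁺`», the standing hypothesis of Rogawski's Ch. 14)

Cell `hodgecm-mathlib`, crux H413 (`stmt-HodgeConjecture-24833`, lane `--supports … --as helper`), route of record `HCCMUnconditional` (count-neutral).  Programme R90-TF,
section S9 (base `R90-IF`); seat R90-IF-p04 (g0), deal p04 (b) «★-closable fragments» of R90-IF-plan (g0) «EMIT S9 WAVE 1» (R90 bus 2026-09-04T15:27:13Z).
THEOREMS ONLY (no `def`, no instance, no notation, no named fact, no `sorry`); imports ★ only; namespace `Summit.HodgeConjecture.HodgeConjecture.R90.S9`.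
HONEST LABEL: HC_CM is proved only modulo the 7 printed citations (2 remaining named inputs: hLiu418 = stmt-HodgeConjecture-24832, h413 = stmt-HodgeConjecture-24833)
— until rung 0 closes.  Pure linear algebra; proves nothing about automorphic forms.

WHAT.  Tree FILE B `Cruxes/H413/Lines/R90_S9_InnerFormTransportB.lean` splits (S-G) by real signatures: (B2)∕(B3) treat `H = ᵗB̄ · (a • Φ₃) · B` (then `U(H) ≃ U(Φ₃)`
over `L⁺`: print's QUASI-SPLIT group, Ch. 13), (B4) treats `H` ANISOTROPIC and definite somewhere (print's genuine inner form, Ch. 14: «We assume that `G′` is not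
isomorphic to `G` over `F`», p. 231; «Since `G′` is anisotropic», §14.5 p. 237).  This file certifies that (B4)'s guard `hanis` EXCLUDES the (B2)∕(B3) shape:
`⟪x, x⟫_{ᵗB̄ M B} = ⟪Bx, Bx⟫_M` (`hermForm_formCongr₃`, folklore) and `Φ₃`'s first basis vector is isotropic (`(Φ₃)₀₀ = 0`), so `ᵗB̄ (a • Φ₃) B` has the isotropic
vector `B⁻¹ e₀ ≠ 0` — `not_exists_formCongr_smul_qsForm_of_anisotropic`.  So on (B4)'s locus §14.6 (not §13.3) is the print that applies, and the HEAD's `by_cases`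
split of FILE B is a genuine dichotomy of GROUPS, not only of signatures.
[cite: Rogawski1990, Ch. 14 p. 231; §14.5 p. 237; §1.9 p. 8] [cite: Landherr1936HermitianForms]
-/

set_option autoImplicit false
-- the mandated namespace repeats `HodgeConjecture.HodgeConjecture`, as in every `Theorems/*.lean` of this sub-problem
set_option linter.dupNamespace false

noncomputable section

open NumberField
open scoped Matrix

open Literature.NumberTheory Literature.NumberTheory.Automorphic Literature.NumberTheory.Automorphic.UnitaryGroup
open Literature.NumberTheory.Rogawski1990

namespace Summit.HodgeConjecture.HodgeConjecture.R90.S9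

/-- **`⟪v, w⟫_{σ(T)ᵀ M T} = ⟪T v, T w⟫_M` in rank 3** (the form of a congruent Gram matrix; the tree's ★ `HLiu418S1BettiSliceExclusion.hermForm_formCongr` is the
rank-2 text, same proof). [folklore] [cite: Rogawski1990, §1.9 p. 8] -/
theorem hermForm_formCongr₃ {L : Type} [Field L] (σ : L →+* L) (T : GL (Fin 3) L) (M : Matrix (Fin 3) (Fin 3) L) (v w : Fin 3 → L) :
    Literature.AlgebraicGeometry.ShimuraVarieties.hermForm σ (formCongr σ T M) v w =
      Literature.AlgebraicGeometry.ShimuraVarieties.hermForm σ M ((T : Matrix (Fin 3) (Fin 3) L) *ᵥ v) ((T : Matrix (Fin 3) (Fin 3) L) *ᵥ w) := by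
  have h1 : (⇑σ ∘ ((T : Matrix (Fin 3) (Fin 3) L) *ᵥ v)) = ((T : Matrix (Fin 3) (Fin 3) L).map σ) *ᵥ (⇑σ ∘ v) :=
    funext fun i => RingHom.map_mulVec σ _ v i
  show (⇑σ ∘ v) ⬝ᵥ ((((T : Matrix (Fin 3) (Fin 3) L).map σ)ᵀ * M * (T : Matrix (Fin 3) (Fin 3) L)) *ᵥ w) =
    (⇑σ ∘ ((T : Matrix (Fin 3) (Fin 3) L) *ᵥ v)) ⬝ᵥ (M *ᵥ ((T : Matrix (Fin 3) (Fin 3) L) *ᵥ w))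
  rw [h1, ← Matrix.mulVec_mulVec, ← Matrix.mulVec_mulVec, Matrix.dotProduct_mulVec (⇑σ ∘ v), Matrix.vecMul_transpose]

/-- **An ANISOTROPIC hermitian `H ∈ M₃(L)` is not of the form `ᵗB̄ · (a • Φ₃) · B`** (`B ∈ GL₃(L)`, `a ∈ L` arbitrary): `Φ₃ = antidiag(1,1,1)` has the isotropic
vector `e₀` (`(Φ₃)₀₀ = 0`), so `ᵗB̄ (a • Φ₃) B` has the isotropic vector `B⁻¹ e₀ ≠ 0`.  In print's words: the unitary group of an anisotropic `H` is an inner form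
`G′` of `G = U(3)` «not isomorphic to `G` over `F`» — (B4)'s guard `hanis` excludes the quasi-split branch (B2)∕(B3) of tree FILE B `R90_S9_InnerFormTransportB`.
No sorry. [cite: Rogawski1990, Ch. 14 p. 231; §14.5 p. 237; §1.9 p. 8] [cite: Landherr1936HermitianForms] -/
theorem not_exists_formCongr_smul_qsForm_of_anisotropic (L : Type) [Field L] [NumberField L] [IsCMField L] (H : Matrix (Fin 3) (Fin 3) L)
    (hanis : ∀ x : Fin 3 → L, Literature.AlgebraicGeometry.ShimuraVarieties.hermForm (cmConjRingHom L) H x x = 0 → x = 0) :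
    ¬ ∃ (B : GL (Fin 3) L) (a : L), formCongr (cmConjRingHom L) B (a • qsForm L) = H := by
  rintro ⟨B, a, hB⟩
  -- the isotropic vector `x = B⁻¹ e₀`
  set x : Fin 3 → L := ((B⁻¹ : GL (Fin 3) L) : Matrix (Fin 3) (Fin 3) L) *ᵥ Pi.single (0 : Fin 3) (1 : L) with hx
  have hBx : (B : Matrix (Fin 3) (Fin 3) L) *ᵥ x = Pi.single (0 : Fin 3) (1 : L) := by
    rw [hx, Matrix.mulVec_mulVec, ← Units.val_mul, mul_inv_cancel, Units.val_one, Matrix.one_mulVec]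
  have hx0 : x ≠ 0 := by
    intro h0
    have := congrArg (fun y : Fin 3 → L => y 0) hBx
    simp only [h0, Matrix.mulVec_zero, Pi.zero_apply, Pi.single_eq_same] at this
    exact zero_ne_one this
  refine hx0 (hanis x ?_)
  rw [← hB, hermForm_formCongr₃, hBx]
  -- `⟪e₀, e₀⟫_{a • Φ₃} = a · (Φ₃)₀₀ = 0`
  show (⇑(cmConjRingHom L) ∘ Pi.single (0 : Fin 3) (1 : L)) ⬝ᵥ ((a • qsForm L) *ᵥ Pi.single (0 : Fin 3) (1 : L)) = 0
  have hσ : (⇑(cmConjRingHom L) ∘ Pi.single (0 : Fin 3) (1 : L)) = Pi.single (0 : Fin 3) (1 : L) := by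
    funext i
    by_cases hi : i = 0
    · subst hi; simp
    · simp [Pi.single_eq_of_ne hi]
  rw [hσ, single_dotProduct, one_mul]
  simp [Matrix.mulVec, dotProduct, qsForm, Pi.single_apply]

end Summit.HodgeConjecture.HodgeConjecture.R90.S9

end
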